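import Summits.ValiantsHypothesis.ValiantsHypothesis.Theorems.SymPencilPerFourHyperplaneFlowRigidity
import Summits.ValiantsHypothesis.ValiantsHypothesis.Theorems.SymPencilPerFourBoxNonvanishing
import Summits.ValiantsHypothesis.ValiantsHypothesis.Theorems.SymPencilSdcPerFourCellTwelveFour

/-!
# Route `SymPencil` — cell `(12,4,2)` of the size-27 table MODULO THE ONE-ROW PENCIL CORE (S1c) only
# (`--supports` stmt-ValiantsHypothesis-5674; rung currency for `sdc(per_4)`; nothing here bears on `VP ≠ VNP`)

val-width-5674-w2 g2 closed the cell `(12,4,2)` modulo the hyperplane flow rigidity `RIG_𝟙`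
(`SymPencilSdcPerFourCellTwelveFour.false_of_rank_twelve_le_twentySeven_of_rigid`) and typed its hard stub S1c
(the one-row pencil core, `SymPencilPerFourHyperplanePencilOrders.exists_kernel_hyperplane_of_X₂_eq_zero`'s
conclusion: `∃ φ, (φ a = 0 → X₀ a = 0 ∧ X₁ a = 0) ∧ (μ c = 0 → X₂ c = 0)`).  With the two-row / one-row files of
`SymPencilPerFourHyperplaneFlow*` and LEMMA N (`SymPencilPerFourBoxNonvanishing.exists_box_point`) this file
removes everything but S1c:

* `core_of_pencilCore` — S1c (stated with `μ ≠ 0`, block-diagonal flow at the base row `𝟙`) ⇒ the `hcore`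
  hypothesis of `SymPencilPerFourHyperplaneFlow.exists_good_point_of_flow_of_core` (good point from the box).
* `rigid_of_pencilCore` — S1c ⇒ `RIG_𝟙` (the `hrig` binder of the cell theorem, verbatim).
* **`false_of_rank_twelve_le_twentySeven_of_pencilCore`** — the cell theorem with `hrig` replaced by S1c.

Honest label: CONDITIONAL on S1c (open; val-width-5674-w2 g2's lane).  One of four open cells of the size-27
table; `27 ≤ sdc(per_4) ≤ 29`, the crux `SdcSuperquadratic` and `VP ≠ VNP` are untouched.  No definitions,
no named facts. [folklore]
-/

noncomputable section

-- single-conjunct layout: Sub = Summit, duplicated namespace component intended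
set_option linter.dupNamespace false

namespace Summit.ValiantsHypothesis.ValiantsHypothesis.Theorems.SymPencilPerFourHyperplaneFlow

open Matrix Module MvPolynomial
open Literature.Computability.AlgebraicComplexity
open Summit.ValiantsHypothesis.ValiantsHypothesis.Theorems.SymPencilPerFourBoxNonvanishing

variable {K : Type*} [Field K] [CharZero K]

/-- **S1c ⇒ the one-row core in good-point form** (base row `𝟙`). [folklore] -/
theorem core_of_pencilCore
    (hS1c : ∀ (X₀ X₁ X₂ : (Fin 4 → K) →ₗ[K] (Fin 4 → K)) (μ : (Fin 4 → K) →ₗ[K] K), μ ≠ 0 →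
      (∀ (a b c : Fin 4 → K) (t : K), μ c = 0 →
        (Matrix.of ![(fun _ => (1 : K)), a + t • X₀ a, b + t • X₁ b, c + t • X₂ c]).permanent =
          (Matrix.of ![(fun _ => (1 : K)), a, b, c]).permanent) →
      ∃ φ : (Fin 4 → K) →ₗ[K] K, (∀ a, φ a = 0 → X₀ a = 0 ∧ X₁ a = 0) ∧ (∀ c, μ c = 0 → X₂ c = 0)) :
    ∀ (μ : (Fin 4 → K) →ₗ[K] K) (Y : Fin 3 → (Fin 4 → K) →ₗ[K] (Fin 4 → K)), μ ≠ 0 →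
      (∀ y : Fin 3 → Fin 4 → K, μ (y 2) = 0 → ∀ s : K,
        (Matrix.of ![(fun _ => (1 : K)), y 0 + s • Y 0 (y 0), y 1 + s • Y 1 (y 1), y 2 + s • Y 2 (y 2)]).permanent =
          (Matrix.of ![(fun _ => (1 : K)), y 0, y 1, y 2]).permanent) →
      ∃ y : Fin 3 → Fin 4 → K, μ (y 2) = 0 ∧ (∀ i, Y i (y i) = 0) ∧
        (Matrix.of ![(fun _ => (1 : K)), y 0, y 1, y 2]).permanent ≠ 0 := by
  intro μ Y hμ hflow
  obtain ⟨φ, hφ, hZ⟩ := hS1c (Y 0) (Y 1) (Y 2) μ hμ fun a b c t hc => by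
    have e := hflow ![a, b, c] (by simpa using hc) t
    simpa using e
  obtain ⟨y₀, y₁, y₂, h₀, h₁, h₂, hF⟩ := exists_box_point φ φ μ
  refine ⟨![y₀, y₁, y₂], by simpa using h₂, fun i => ?_, by simpa using hF⟩
  fin_cases i
  · simpa using (hφ y₀ h₀).1
  · simpa using (hφ y₁ h₁).2
  · simpa using hZ y₂ h₂

/-- **S1c ⇒ `RIG_𝟙`** (the `hrig` hypothesis of `…CellTwelveFour.false_of_rank_twelve_le_twentySeven_of_rigid`,
verbatim). [folklore] -/
theorem rigid_of_pencilCore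
    (hS1c : ∀ (X₀ X₁ X₂ : (Fin 4 → K) →ₗ[K] (Fin 4 → K)) (μ : (Fin 4 → K) →ₗ[K] K), μ ≠ 0 →
      (∀ (a b c : Fin 4 → K) (t : K), μ c = 0 →
        (Matrix.of ![(fun _ => (1 : K)), a + t • X₀ a, b + t • X₁ b, c + t • X₂ c]).permanent =
          (Matrix.of ![(fun _ => (1 : K)), a, b, c]).permanent) →
      ∃ φ : (Fin 4 → K) →ₗ[K] K, (∀ a, φ a = 0 → X₀ a = 0 ∧ X₁ a = 0) ∧ (∀ c, μ c = 0 → X₂ c = 0)) :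
    ∀ (X : (Fin 3 → Fin 4 → K) →ₗ[K] (Fin 3 → Fin 4 → K)) (ℓ : (Fin 3 → Fin 4 → K) →ₗ[K] K),
      (∀ y, ℓ y = 0 → ∀ t : K,
        (Matrix.of ![fun _ => (1 : K), (y + t • X y) 0, (y + t • X y) 1, (y + t • X y) 2]).permanent =
          (Matrix.of ![fun _ => (1 : K), y 0, y 1, y 2]).permanent) →
      ∃ y, ℓ y = 0 ∧ X y = 0 ∧ (Matrix.of ![fun _ => (1 : K), y 0, y 1, y 2]).permanent ≠ 0 :=
  fun X ℓ h => exists_good_point_of_flow_of_core (v := fun _ => (1 : K)) (fun _ => one_ne_zero)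
    (core_of_pencilCore hS1c) X ℓ h

/-- **Cell `(12,4,2)` of the size-27 table is EMPTY MODULO S1c** (the one-row pencil core): the binder block of
`SymPencilSdcPerFourCellTwelveFour.false_of_rank_twelve_le_twentySeven_of_rigid` with `hrig` replaced by the
S1c statement. [folklore] -/
theorem false_of_rank_twelve_le_twentySeven_of_pencilCore [IsAlgClosed K] {m : ℕ} (hm : m ≤ 27)
    {i₀ : Fin m} {D : Matrix {i // i ≠ i₀} {i // i ≠ i₀} K}
    {bL : (Fin 4 × Fin 4 → K) →ₗ[K] ({i // i ≠ i₀} → K)}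
    {CL : (Fin 4 × Fin 4 → K) →ₗ[K] Matrix {i // i ≠ i₀} {i // i ≠ i₀} K} {κ : K}
    (hD : IsUnit D.det) (hDs : Dᵀ = D) (hCs : ∀ z, (CL z)ᵀ = CL z) (hκ : κ ≠ 0)
    (hi : ∀ z, bL z ⬝ᵥ D⁻¹ *ᵥ bL z = 0)
    (hii : ∀ z, bL z ⬝ᵥ (D⁻¹ * CL z * D⁻¹) *ᵥ bL z = 0)
    (hiii : ∀ z, D.det * (bL z ⬝ᵥ (D⁻¹ * CL z * D⁻¹ * CL z * D⁻¹) *ᵥ bL z) =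
      -(κ * eval z (perPoly (Fin 4) K)))
    (hcard : Fintype.card {i // i ≠ i₀} + 1 = m)
    (hrn : finrank K (LinearMap.range bL) + finrank K (LinearMap.ker bL) = 16)
    (hN : ∀ v, bL v = 0 → IsUnit (D + CL v).det ∧ ∀ (z : Fin 4 × Fin 4 → K) (s : K),
      κ * eval (v + s • z) (perPoly (Fin 4) K) =
        (Matrix.fromBlocks ((s * 0) • (1 : Matrix Unit Unit K))
          (Matrix.replicateRow Unit (s • bL z)) (Matrix.replicateCol Unit (s • bL z))
          (D + CL v + s • CL z)).det)
    (hS1c : ∀ (X₀ X₁ X₂ : (Fin 4 → K) →ₗ[K] (Fin 4 → K)) (μ : (Fin 4 → K) →ₗ[K] K), μ ≠ 0 →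
      (∀ (a b c : Fin 4 → K) (t : K), μ c = 0 →
        (Matrix.of ![(fun _ => (1 : K)), a + t • X₀ a, b + t • X₁ b, c + t • X₂ c]).permanent =
          (Matrix.of ![(fun _ => (1 : K)), a, b, c]).permanent) →
      ∃ φ : (Fin 4 → K) →ₗ[K] K, (∀ a, φ a = 0 → X₀ a = 0 ∧ X₁ a = 0) ∧ (∀ c, μ c = 0 → X₂ c = 0))
    (h12 : finrank K (LinearMap.range bL) = 12) : False :=
  SymPencilSdcPerFourCellTwelveFour.false_of_rank_twelve_le_twentySeven_of_rigid K hm hD hDs hCs hκ hi hii hiii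
    hcard hrn hN (rigid_of_pencilCore hS1c) h12

end Summit.ValiantsHypothesis.ValiantsHypothesis.Theorems.SymPencilPerFourHyperplaneFlow

end
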